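import Literature.MathematicalPhysics.KineticTheory.HardSphereMeanCollisionCount
import Summits.AtomisticToContinuum.HydrodynamicLimit.Theorems.SpeedCapSurgeryMaxSpeedBoundLogEnergeticCountTools
import Summits.AtomisticToContinuum.HydrodynamicLimit.Theorems.OneFlightGossipEngineEnergyCurrentTailsLevelCensusEventMeasurable
import Summits.AtomisticToContinuum.HydrodynamicLimit.Theorems.JParityClosureCollisionTightnessSweptTube
import Summits.AtomisticToContinuum.HydrodynamicLimit.Theorems.JParityClosureCollisionTightnessTorusGibbs
import Summits.AtomisticToContinuum.HydrodynamicLimit.Theorems.JParityClosureOddContactSymmetryGibbsInvariance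
import HarnessLib

/-!
# Energetic collisions are rare in the mean under the homogeneous Gibbs law

Helper file of the crux line `registered` (birth skeleton) of `SpeedCapSurgery.MaxSpeedBoundLog`
(stmt-AtomisticToContinuum-9629), `--supports` that item: the DYNAMIC stub of the line
(`stub_energeticCollisionsRare`: "collision times in `(0,t]` whose colliding pair has kinetic energy
above `C² log(N+2)` have a measurable count-majorant of vanishing expectation") PROVED IN THE
CALIBRATION CASE of constant profiles `a₀ ≡ 1`, `u₀ ≡ 0`, `θ₀ ≡ θe` — the flow-invariant homogeneous
Gibbs law of the route's support item `EquilibriumMaxSpeed` (stmt-9632, § Numbers of the route: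
"equilibrium contact count on `[0,t]` with outgoing speed `> λ`: `≲ t σ²(N+1)^{4/3} λ e^{-λ²/2θ}`").

First-moment method over collisions, on the tree's machinery:

* pathwise counting and the Gaussian tail of the energetic flux:
  `SpeedCapSurgeryMaxSpeedBoundLogEnergeticCountTools` (`ncard_energetic_le_eventSum`,
  `eventSum_le_markSum`, `exists_flux_tail_bound`);
* MEASURABILITY: `censusLedger_eventMeasurable` (the dyadic velocity-jump engine of the tree) makes
  `Φ.good.indicator (eventSum …)` a MEASURABLE majorant of the energetic-collision count;
* MEAN (`lintegral_indicator_eventSum_le`): the collision-flux bound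
  `localGibbsLaw_lintegral_le_of_le_collisionMarkSum` (Cercignani–Illner–Pulvirenti 1994 App. 4.A,
  one-window form) under the invariant law (`measurePreserving_flow_localGibbsLaw_const`), with the
  canonical pair bound `C_p = 5` (`posGibbs_pairEvent_le_five`), the swept tubes (`exists_sweptTube`)
  and the minimal-image lift inequality (`volume_setOf_exists_reprSym_add_latticeVec_mem_le`):
  `E[#energetic] ≤ 5 · 4t(N+1)²ε² · ∫ ‖w − v‖ 𝟙{c² < ‖v‖²+‖w‖²} dN(0,θe)^{⊗2}`;
* ASSEMBLY (`equilibrium_energeticCollisionsRare`, the exact shape of the line's stub 3 at constant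
  profiles): at `c² = C² log(N+2)` with `α C² = 3` the flux tail is `K (N+2)^{-3}` and
  `(N+1)² ε² ≤ (N+2)²/4`, so the mean is `≤ 5tK/(N+2) → 0`.

References: C. Cercignani, R. Illner, M. Pulvirenti, *The Mathematical Theory of Dilute Gases*
(1994), App. 4.A; H. Spohn, *Large Scale Dynamics of Interacting Particles* (1991), Part I §2.3.
-/

noncomputable section

open MeasureTheory ProbabilityTheory Set Filter Topology
open scoped ENNReal InnerProductSpace BigOperators

namespace Summit.AtomisticToContinuum.HydrodynamicLimit.Theorems.MaxSpeedBoundLogLine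

open Literature.MathematicalPhysics.KineticTheory Literature.Analysis.FluidPDE Literature.Analysis.FunctionSpaces
open Summit.AtomisticToContinuum.HydrodynamicLimit.Theorems.EnergyCurrentTailsLevelCensus
open Summit.AtomisticToContinuum.HydrodynamicLimit.Theorems

/-! ## The mean of the velocity-event count under the homogeneous Gibbs law -/

/-- **The collision-flux bound for the energetic velocity-event count under `G_N`.** For
`0 < σ < 1/2`, `θe > 0`, `N ≥ 1`, a flow `Φ` of the crux frame and `t > 0`: the mean under the
homogeneous Gibbs law `G_N = localGibbsLaw σ 1 0 θe N Φ` of the (good-set-extended) count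
`eventSum Φ 0 t {c² < ‖v₁⁺‖² + ‖v₂⁺‖²}` is at most
`5 · 4t(N+1)²ε² · ∫ ‖w − v‖ 𝟙{c² < ‖v‖² + ‖w‖²} dN(0,θe)^{⊗2}` — the tree's mean collision-flux
bound `localGibbsLaw_lintegral_le_of_le_collisionMarkSum` (CIP 1994 App. 4.A) with the invariance of
`G_N` (`measurePreserving_flow_localGibbsLaw_const`), the canonical pair bound `C_p = 5`
(`posGibbs_pairEvent_le_five`), the swept tubes (`exists_sweptTube`) and the minimal-image lift
inequality (`volume_setOf_exists_reprSym_add_latticeVec_mem_le`). -/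
theorem lintegral_indicator_eventSum_le {σ : ℝ} (hσ : 0 < σ) (hσ2 : σ < 1 / 2) {θe : ℝ}
    (hθe : 0 < θe) {N : ℕ} (hN : 1 ≤ N) (Φ : Flow σ N) {t : ℝ} (ht : 0 < t) (c : ℝ) :
    ∫⁻ z, Φ.good.indicator (eventSum Φ 0 t {q : VelEvent | c ^ 2 < ‖q.2.1‖ ^ 2 + ‖q.2.2‖ ^ 2}) z
        ∂(localGibbsLaw σ (fun _ => (1 : ℝ)) (fun _ => (0 : V3)) (fun _ => θe) N Φ) ≤
      5 * ENNReal.ofReal (4 * t * ((N + 1 : ℕ) : ℝ) ^ 2 * hsDiameter σ N ^ 2) *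
        ∫⁻ p, ENNReal.ofReal ‖p.2 - p.1‖ *
            Set.indicator {p : V3 × V3 | c ^ 2 < ‖p.1‖ ^ 2 + ‖p.2‖ ^ 2} (fun _ => (1 : ℝ≥0∞)) p
          ∂((gaussMeasure (0 : V3) θe).prod (gaussMeasure (0 : V3) θe)) := by
  have hε : 0 < hsDiameter σ N := hsDiameter_pos hσ N
  have hlift : ∀ B : Set V3, MeasurableSet B →
      volume {x : T3 | ∃ k : Fin 3 → ℤ, Torus.reprSym x + Torus.latticeVec k ∈ B} ≤ volume B :=
    fun B hB => by simpa only [sub_zero] using volume_setOf_exists_reprSym_add_latticeVec_mem_le 0 hB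
  have htube : ∀ h : ℝ, 0 ≤ h → ∃ S : V3 → Set V3, MeasurableSet {q : V3 × V3 | q.1 ∈ S q.2} ∧
      (∀ u, volume (S u) ≤ ENNReal.ofReal (4 * hsDiameter σ N ^ 2 * h * ‖u‖)) ∧
      ∀ (u r : V3) (s : ℝ), hsDiameter σ N ≤ ‖r‖ → s ∈ Icc 0 h → ‖r + s • u‖ = hsDiameter σ N →
        r ∈ S u :=
    fun h hh => exists_sweptTube hε hh
  have hpair : ∀ i j : Fin (N + 1), i ≠ j → ∀ T : Set T3, MeasurableSet T →
      posGibbsMeasure (fun _ : T3 => (1 : ℝ)) (hsDiameter σ N) (N + 1) {x | x i - x j ∈ T} ≤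
        5 * volume T :=
    fun i j hij T hT => posGibbs_pairEvent_le_five hσ.le (by linarith) hN hij hT
  have hbm : Measurable (Set.indicator {p : V3 × V3 | c ^ 2 < ‖p.1‖ ^ 2 + ‖p.2‖ ^ 2}
      (fun _ => (1 : ℝ≥0∞))) :=
    measurable_const.indicator (measurableSet_lt measurable_const (by fun_prop))
  refine localGibbsLaw_lintegral_le_of_le_collisionMarkSum (by linarith) one_pos hθe (0 : V3) Φ
    (measurePreserving_flow_localGibbsLaw_const σ 1 θe (0 : V3) N Φ) hpair htube hlift ht hbm _ ?_
  intro z hz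
  rw [indicator_of_mem hz]
  exact eventSum_le_markSum hσ Φ hz c t

/-! ## The calibration case of stub 3: energetic collisions are rare under `G_N` -/

/-- **Energetic collisions are rare in the mean under the homogeneous Gibbs law** — the dynamic stub
`stub_energeticCollisionsRare` of the line, in its exact shape, for the constant profiles
`a₀ ≡ 1`, `u₀ ≡ 0`, `θ₀ ≡ θe` of `EquilibriumMaxSpeed`: for `θe > 0` there is `σ₀ = 1/2` such that
for `0 < σ < σ₀`, `t ≥ 0` and every flow family there are `C ≥ 0` and MEASURABLE majorants `g N`
of the number of collision times `r ∈ (0, t]` whose colliding pair has kinetic energy above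
`C² log(N+2)`, on good orbits, with `∫ g N dG_N → 0`. Proof: `g N = 𝟙_good · eventSum`
(`censusLedger_eventMeasurable`, `ncard_energetic_le_eventSum`); its mean is
`≤ 5·4t(N+1)²ε²·K e^{-αC² log(N+2)}` (`lintegral_indicator_eventSum_le`, `exists_flux_tail_bound`);
with `α C² = 3` and `(N+1)²ε² ≤ (N+2)²/4` this is `≤ 5tK/(N+2) → 0`. -/
theorem equilibrium_energeticCollisionsRare :
    ∀ θe : ℝ, 0 < θe → ∃ σ₀ : ℝ, 0 < σ₀ ∧ ∀ σ : ℝ, 0 < σ → σ < σ₀ → ∀ t : ℝ, 0 ≤ t → ∀ Φ : (N : ℕ) →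
      Literature.Analysis.FluidPDE.HardSphereFlow (Literature.Analysis.FluidPDE.Torus.geometry (Fin
      3)) (Literature.MathematicalPhysics.KineticTheory.hsDiameter σ N) (N + 1), ∃ C : ℝ, 0 ≤ C ∧ ∃
      g : (N : ℕ) → Literature.Analysis.FluidPDE.Config (N + 1) (Fin 3)
      Literature.MathematicalPhysics.KineticTheory.T3 → ENNReal, (∀ N, Measurable (g N)) ∧ (∀ N, ∀ z
      ∈ (Φ N).good, ((Set.ncard {r ∈ Set.Ioc 0 t | ∃ i j : Fin (N + 1), i ≠ j ∧ (Φ N).flow r z ∈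
      Literature.Analysis.FluidPDE.contactSet (Literature.Analysis.FluidPDE.Torus.geometry (Fin 3))
      (N + 1) (Literature.MathematicalPhysics.KineticTheory.hsDiameter σ N) i j ∧ (C * Real.sqrt
      (Real.log ((N : ℝ) + 2))) ^ 2 < ‖((Φ N).flow r z i).2‖ ^ 2 + ‖((Φ N).flow r z j).2‖ ^ 2} : ℕ)
      : ENNReal) ≤ g N z) ∧ Filter.Tendsto (fun N : ℕ => ∫⁻ z, g N z
      ∂(Literature.MathematicalPhysics.KineticTheory.localGibbsLaw σ (fun _ => (1 : ℝ)) (fun _ => (0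
      : Literature.MathematicalPhysics.KineticTheory.V3)) (fun _ => θe) N (Φ N))) Filter.atTop (nhds
      0) := by
  intro θe hθe
  refine ⟨1 / 2, by norm_num, fun σ hσ hσ2 t ht Φ => ?_⟩
  -- the window `(0, 0]` is empty: nothing to count
  rcases ht.eq_or_lt with rfl | htpos
  · refine ⟨0, le_rfl, fun _ _ => 0, fun _ => measurable_const, fun N z _ => ?_, ?_⟩
    swap
    · simpa only [lintegral_zero] using tendsto_const_nhds
    have hempty : {r ∈ Set.Ioc (0 : ℝ) 0 | ∃ i j : Fin (N + 1), i ≠ j ∧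
        (Φ N).flow r z ∈ contactSet (Torus.geometry (Fin 3)) (N + 1) (hsDiameter σ N) i j ∧
        (0 * Real.sqrt (Real.log ((N : ℝ) + 2))) ^ 2 <
          ‖((Φ N).flow r z i).2‖ ^ 2 + ‖((Φ N).flow r z j).2‖ ^ 2} = ∅ := by
      ext r
      simp only [Set.Ioc_self, mem_empty_iff_false, false_and, mem_setOf_eq]
    rw [hempty, Set.ncard_empty, Nat.cast_zero]
  -- the Gaussian tail of the flux and the constant `C` with `α C² = 3`
  obtain ⟨α, hα, K, hK, hflux⟩ := exists_flux_tail_bound θe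
  set C : ℝ := Real.sqrt (3 / α) with hC
  have hC0 : 0 ≤ C := Real.sqrt_nonneg _
  have hαC : α * C ^ 2 = 3 := by
    rw [hC, Real.sq_sqrt (by positivity)]
    field_simp
  -- the majorants
  set S : ℕ → Set VelEvent := fun N =>
    {q | (C * Real.sqrt (Real.log ((N : ℝ) + 2))) ^ 2 < ‖q.2.1‖ ^ 2 + ‖q.2.2‖ ^ 2} with hS
  set g : (N : ℕ) → Config (N + 1) (Fin 3) T3 → ℝ≥0∞ := fun N =>
    (Φ N).good.indicator (eventSum (Φ N) 0 t (S N)) with hg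
  refine ⟨C, hC0, g, fun N => ?_, fun N z hz => ?_, ?_⟩
  · exact censusLedger_eventMeasurable σ hσ hσ2 N (Φ N) 0 t (S N) (measurableSet_energeticEvent _)
  · simp only [hg, indicator_of_mem hz]
    exact ncard_energetic_le_eventSum hσ hσ2 (Φ N) hz _ t
  -- the mean bound for `N ≥ 1`: `≤ 5 · 4t(N+1)²ε² · K e^{-3 log(N+2)} ≤ 5tK/(N+2)`
  have hKr : K.toReal < K.toReal + 1 := lt_add_one _
  set A : ℝ := 5 * t * (K.toReal + 1) with hA
  have hbound : ∀ N : ℕ, 1 ≤ N →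
      ∫⁻ z, g N z ∂(localGibbsLaw σ (fun _ => (1 : ℝ)) (fun _ => (0 : V3)) (fun _ => θe) N (Φ N)) ≤
        ENNReal.ofReal (A / ((N : ℝ) + 2)) := by
    intro N hN
    have h1 := lintegral_indicator_eventSum_le hσ hσ2 hθe hN (Φ N) htpos
      (C * Real.sqrt (Real.log ((N : ℝ) + 2)))
    have h2 := hflux (C * Real.sqrt (Real.log ((N : ℝ) + 2)))
    -- the exponential factor is `(N+2)^{-3}`
    have hN2 : (0 : ℝ) < (N : ℝ) + 2 := by positivity
    have hlog : 0 ≤ Real.log ((N : ℝ) + 2) := Real.log_nonneg (by linarith)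
    have hexp : Real.exp (-(α * (C * Real.sqrt (Real.log ((N : ℝ) + 2))) ^ 2)) = ((N : ℝ) + 2)⁻¹ ^ 3 := by
      rw [mul_pow, Real.sq_sqrt hlog, ← mul_assoc, hαC, show (3 : ℝ) * Real.log ((N : ℝ) + 2) =
        ((3 : ℕ) : ℝ) * Real.log ((N : ℝ) + 2) by norm_num, ← Real.log_pow, Real.exp_neg,
        Real.exp_log (by positivity), inv_pow]
    -- `(N+1)² ε² ≤ (N+2)² / 4` (`ε ≤ σ < 1/2`)
    have hεσ : hsDiameter σ N ^ 2 ≤ (1 / 2) ^ 2 :=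
      pow_le_pow_left₀ (hsDiameter_pos hσ N).le ((hsDiameter_le hσ.le N).trans hσ2.le) 2
    have hgeom : 4 * t * ((N + 1 : ℕ) : ℝ) ^ 2 * hsDiameter σ N ^ 2 ≤ t * ((N : ℝ) + 2) ^ 2 := by
      have hN1 : ((N + 1 : ℕ) : ℝ) ^ 2 ≤ ((N : ℝ) + 2) ^ 2 := by
        push_cast
        nlinarith
      calc 4 * t * ((N + 1 : ℕ) : ℝ) ^ 2 * hsDiameter σ N ^ 2
          ≤ 4 * t * ((N : ℝ) + 2) ^ 2 * (1 / 2) ^ 2 := by gcongr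
        _ = t * ((N : ℝ) + 2) ^ 2 := by ring
    have hKofReal : K ≤ ENNReal.ofReal (K.toReal + 1) :=
      calc K = ENNReal.ofReal K.toReal := (ENNReal.ofReal_toReal hK.ne).symm
        _ ≤ ENNReal.ofReal (K.toReal + 1) := ENNReal.ofReal_le_ofReal hKr.le
    calc ∫⁻ z, g N z ∂(localGibbsLaw σ (fun _ => (1 : ℝ)) (fun _ => (0 : V3)) (fun _ => θe) N (Φ N))
        ≤ 5 * ENNReal.ofReal (4 * t * ((N + 1 : ℕ) : ℝ) ^ 2 * hsDiameter σ N ^ 2) *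
            (K * ENNReal.ofReal (Real.exp (-(α * (C * Real.sqrt (Real.log ((N : ℝ) + 2))) ^ 2)))) :=
          h1.trans (by gcongr)
      _ ≤ 5 * ENNReal.ofReal (t * ((N : ℝ) + 2) ^ 2) *
            (ENNReal.ofReal (K.toReal + 1) * ENNReal.ofReal (((N : ℝ) + 2)⁻¹ ^ 3)) := by
          rw [hexp]
          gcongr
      _ = ENNReal.ofReal (A / ((N : ℝ) + 2)) := by
          rw [← ENNReal.ofReal_ofNat 5, ← ENNReal.ofReal_mul (by norm_num),
            ← ENNReal.ofReal_mul (by positivity), ← ENNReal.ofReal_mul (by positivity)]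
          congr 1
          rw [hA]
          field_simp
  -- squeeze
  have hlim : Tendsto (fun N : ℕ => ENNReal.ofReal (A / ((N : ℝ) + 2))) atTop (𝓝 0) := by
    rw [← ENNReal.ofReal_zero]
    refine ENNReal.tendsto_ofReal ?_
    have h : Tendsto (fun N : ℕ => (N : ℝ) + 2) atTop atTop :=
      tendsto_atTop_add_const_right _ _ tendsto_natCast_atTop_atTop
    exact h.const_div_atTop A |>.congr fun N => rfl
  refine tendsto_of_tendsto_of_tendsto_of_le_of_le' tendsto_const_nhds hlim
    (Eventually.of_forall fun N => bot_le) ?_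
  filter_upwards [eventually_ge_atTop 1] with N hN using hbound N hN

end Summit.AtomisticToContinuum.HydrodynamicLimit.Theorems.MaxSpeedBoundLogLine

end
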